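import Literature.Analysis.FluidPDE.AncientLimitVanishing
import HarnessLib

/-!
# Non-triviality of the Case-1 zoom limit (tool for stub Z4 `stub_caseOneZoom` of the line `radius_dichotomy`,
# item `TerminalTrace.TypeITraceScarL3`, stmt-NavierStokesRegularity-18385)

Seat nsreg-C26-p1 g5 (cell ns-regularity-ideate), `--supports stmt-NavierStokesRegularity-18385`.

`not_ae_zero_of_seqLimit_of_not_bounded`: let `(F_j, P_j)` be suitable weak solutions in `Q_3(0)`, a.e. bounded by
`L` there, with `∫_{Q_3(0)} |P_j|^{3/2} ≤ D`, and NOT a.e. bounded by `1/2` on `Q_2(0)`. If `F_j → w` in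
`L³(Q_3(0))` then `w` is not a.e. zero on `Q_3(0)`.  Proof: Serrin's interior regularity with the printed dependence
of the norms (`NSBoundedHigherRegularityBounds_holds`, data `(R, M, P) = (3, L, D)`) gives each `F_j` a representative
`V_j` which is HÖLDER continuous on `Q_{5/2}(0)` in space–time with constants `(C₀, α₀)` INDEPENDENT of `j`; the
failure of the bound `1/2` produces a point `z_j ∈ Q_2(0)` with `|V_j(z_j)| > 1/2`, hence `|V_j| ≥ 1/4` on the box
`]t_j − d₀, t_j[ × B(x_j, d₀)`, `C₀ d₀^{α₀} ≤ 1/4`, of measure `m₀ > 0` independent of `j`; so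
`∫_{Q_3}|F_j|³ ≥ m₀/64` for all `j`, incompatible with `F_j → 0` in `L³(Q_3)`.
WHAT THIS IS NOT: 18385 / NS regularity NOT proved. [cite: SereginSverak2009, §2 p. 8] [cite: EscauriazaSereginSverak2003, §3]
-/

noncomputable section

set_option linter.dupNamespace false

namespace Summit.NavierStokesRegularity.NavierStokesRegularity.Theorems.TypeITraceScarL3

open MeasureTheory Set Function Filter Topology TopologicalSpace Metric
open Literature.Analysis.FluidPDE
open scoped NNReal ENNReal

set_option maxHeartbeats 1600000 in
/-- **The failure of the `L^∞` bound `1/2` on `Q_2(0)` survives strong `L³(Q_3(0))` limits of uniformly bounded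
suitable weak solutions with uniformly bounded pressures** (k-uniform Hölder continuity of the Serrin
representatives, `NSBoundedHigherRegularityBounds_holds`). [cite: SereginSverak2009, §2 p. 8] -/
theorem not_ae_zero_of_seqLimit_of_not_bounded
    {F : ℕ → ℝ → EuclideanSpace ℝ (Fin 3) → EuclideanSpace ℝ (Fin 3)} {P : ℕ → ℝ → EuclideanSpace ℝ (Fin 3) → ℝ}
    (hsw : ∀ j, IsSuitableWeakSolutionInBall 3 (0 : ℝ × EuclideanSpace ℝ (Fin 3)) (F j) (P j))
    {L : ℝ} (hL : ∀ j, ∀ᵐ w ∂(volume.restrict (parabolicCylinder 3 (0 : ℝ × EuclideanSpace ℝ (Fin 3)))),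
      ‖F j w.1 w.2‖ ≤ L)
    {D : ℝ≥0} (hP : ∀ j, ∫⁻ w in parabolicCylinder 3 (0 : ℝ × EuclideanSpace ℝ (Fin 3)),
      ‖P j w.1 w.2‖ₑ ^ (3 / 2 : ℝ) ≤ D)
    (hnot : ∀ j, ¬ (∀ᵐ w ∂(volume.restrict (parabolicCylinder 2 (0 : ℝ × EuclideanSpace ℝ (Fin 3)))),
      ‖F j w.1 w.2‖ ≤ 2⁻¹))
    {w : ℝ → EuclideanSpace ℝ (Fin 3) → EuclideanSpace ℝ (Fin 3)}
    (hconv : Tendsto (fun j => eLpNorm (uncurry (F j) - uncurry w) 3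
      (volume.restrict (parabolicCylinder 3 (0 : ℝ × EuclideanSpace ℝ (Fin 3))))) atTop (𝓝 0)) :
    ¬ (∀ᵐ z ∂(volume.restrict (parabolicCylinder 3 (0 : ℝ × EuclideanSpace ℝ (Fin 3)))), w z.1 z.2 = 0) := by
  intro hzero
  set Q3 : Set (ℝ × EuclideanSpace ℝ (Fin 3)) := parabolicCylinder 3 (0 : ℝ × EuclideanSpace ℝ (Fin 3)) with hQ3
  set μ3 : Measure (ℝ × EuclideanSpace ℝ (Fin 3)) := volume.restrict Q3 with hμ3
  -- ## the uniform Hölder constants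
  obtain ⟨K, C, α, hα, hreg⟩ := NSBoundedHigherRegularityBounds_holds 3 L D
  set C₀ : ℝ≥0 := C 0 (5 / 2) with hC₀
  set α₀ : ℝ≥0 := α 0 (5 / 2) with hα₀
  have hα₀pos : 0 < α₀ := hα 0 (5 / 2) ⟨by norm_num, by norm_num⟩
  have hα₀pos' : 0 < (α₀ : ℝ) := hα₀pos
  -- the radius `d₀ ≤ 1/4` with `C₀ d₀^{α₀} ≤ 1/4`
  set d₀ : ℝ := min (1 / 4) ((1 / (4 * (C₀ : ℝ) + 1)) ^ (1 / (α₀ : ℝ))) with hd₀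
  have hc4 : 0 < 4 * (C₀ : ℝ) + 1 := by positivity
  have hd₀pos : 0 < d₀ := lt_min (by norm_num) (Real.rpow_pos_of_pos (by positivity) _)
  have hd₀le : d₀ ≤ 1 / 4 := min_le_left _ _
  have hCd : (C₀ : ℝ) * d₀ ^ (α₀ : ℝ) ≤ 1 / 4 := by
    have h1 : d₀ ^ (α₀ : ℝ) ≤ ((1 / (4 * (C₀ : ℝ) + 1)) ^ (1 / (α₀ : ℝ))) ^ (α₀ : ℝ) :=
      Real.rpow_le_rpow hd₀pos.le (min_le_right _ _) hα₀pos'.le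
    rw [← Real.rpow_mul (by positivity), one_div_mul_cancel hα₀pos'.ne', Real.rpow_one] at h1
    have h2 : (C₀ : ℝ) * d₀ ^ (α₀ : ℝ) ≤ (C₀ : ℝ) * (1 / (4 * (C₀ : ℝ) + 1)) :=
      mul_le_mul_of_nonneg_left h1 C₀.coe_nonneg
    refine h2.trans ?_
    rw [mul_one_div, div_le_iff₀ hc4]
    linarith [C₀.coe_nonneg]
  -- ## the lower bound `m₀` of `∫_{Q_3} |F_j|³`
  set m₀ : ℝ≥0∞ := ENNReal.ofReal (4⁻¹ : ℝ) ^ (3 : ℕ) *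
    (ENNReal.ofReal d₀ * volume (ball (0 : EuclideanSpace ℝ (Fin 3)) d₀)) with hm₀
  have hm₀pos : 0 < m₀ := by
    refine ENNReal.mul_pos (pow_ne_zero _ (ENNReal.ofReal_pos.2 (by norm_num)).ne') ?_
    exact (ENNReal.mul_pos (ENNReal.ofReal_pos.2 hd₀pos).ne' (measure_ball_pos volume _ hd₀pos).ne').ne'
  have hlow : ∀ j, m₀ ≤ ∫⁻ z in Q3, ‖F j z.1 z.2‖ₑ ^ (3 : ℕ) := by
    intro j
    -- the Hölder representative
    have hsol : IsDistributionalNSSolutionOn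
        (parabolicCylinderOpens 3 (0 : ℝ × EuclideanSpace ℝ (Fin 3))) 1 0 (F j) (P j) :=
      (hsw j).1.distributional
    obtain ⟨V, hae, -, hH⟩ := hreg (F j) (P j) 0 hsol (hL j) (hP j)
    have hHol := (hH 0 (5 / 2) ⟨by norm_num, by norm_num⟩).1
    -- a point of `Q_2(0)` where `|V| > 1/2`
    have hQ23 : parabolicCylinder 2 (0 : ℝ × EuclideanSpace ℝ (Fin 3)) ⊆ Q3 :=
      parabolicCylinder_mono (by norm_num) (by norm_num) _
    have hpt : ∃ z ∈ parabolicCylinder 2 (0 : ℝ × EuclideanSpace ℝ (Fin 3)), 2⁻¹ < ‖V z.1 z.2‖ := by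
      by_contra hcon
      push Not at hcon
      apply hnot j
      have h1 : ∀ᵐ w ∂(volume.restrict (parabolicCylinder 2 (0 : ℝ × EuclideanSpace ℝ (Fin 3)))),
          uncurry (F j) w = uncurry V w := ae_restrict_of_ae_restrict_of_subset hQ23 hae
      filter_upwards [h1, ae_restrict_mem (isOpen_parabolicCylinder _ _).measurableSet] with w hw hwQ
      have : ‖uncurry (F j) w‖ ≤ 2⁻¹ := by rw [hw]; exact hcon w hwQ
      exact this
    obtain ⟨z, hzQ2, hzV⟩ := hpt
    rw [SuitableCompactness.mem_parabolicCylinder_zero] at hzQ2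
    -- the box around `z`
    set E : Set (ℝ × EuclideanSpace ℝ (Fin 3)) := Ioo (z.1 - d₀) z.1 ×ˢ ball z.2 d₀ with hE
    have hEQ : E ⊆ parabolicCylinder (5 / 2) (0 : ℝ × EuclideanSpace ℝ (Fin 3)) := by
      rintro ⟨s, y⟩ ⟨hs, hy⟩
      rw [SuitableCompactness.mem_parabolicCylinder_zero]
      rw [mem_ball, dist_eq_norm] at hy
      refine ⟨⟨by simp only; linarith [hs.1, hzQ2.1.1], by simp only; linarith [hs.2, hzQ2.1.2]⟩, ?_⟩
      calc ‖y‖ = ‖(y - z.2) + z.2‖ := by rw [sub_add_cancel]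
        _ ≤ ‖y - z.2‖ + ‖z.2‖ := norm_add_le _ _
        _ < 5 / 2 := by linarith [hzQ2.2]
    have hEQ3 : E ⊆ Q3 := hEQ.trans (parabolicCylinder_mono (by norm_num) (by norm_num) _)
    have hzQ' : z ∈ parabolicCylinder (5 / 2) (0 : ℝ × EuclideanSpace ℝ (Fin 3)) := by
      rw [SuitableCompactness.mem_parabolicCylinder_zero]
      exact ⟨⟨by linarith [hzQ2.1.1], hzQ2.1.2⟩, by linarith [hzQ2.2]⟩
    -- `|V| ≥ 1/4` on the box
    have hVE : ∀ q ∈ E, (4⁻¹ : ℝ) ≤ ‖V q.1 q.2‖ := by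
      rintro q hq
      have hdist : dist q z ≤ d₀ := by
        obtain ⟨hs, hy⟩ := hq
        rw [Prod.dist_eq]
        refine max_le ?_ (le_of_lt (mem_ball.1 hy))
        rw [Real.dist_eq, abs_le]
        exact ⟨by linarith [hs.1], by linarith [hs.2]⟩
      have hd := hHol.dist_le_of_le (hEQ hq) hzQ' hdist
      simp only [iteratedFDeriv_zero_eq_comp, Function.comp_apply, LinearIsometryEquiv.dist_map] at hd
      rw [dist_eq_norm] at hd
      have h1 : ‖V z.1 z.2‖ ≤ ‖V q.1 q.2‖ + ‖V q.1 q.2 - V z.1 z.2‖ := by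
        calc ‖V z.1 z.2‖ = ‖V q.1 q.2 - (V q.1 q.2 - V z.1 z.2)‖ := by rw [sub_sub_cancel]
          _ ≤ ‖V q.1 q.2‖ + ‖V q.1 q.2 - V z.1 z.2‖ := norm_sub_le _ _
      have h2 : ‖V q.1 q.2 - V z.1 z.2‖ ≤ 1 / 4 := hd.trans hCd
      have h3 : (2⁻¹ : ℝ) = 1 / 2 := by norm_num
      rw [show (4⁻¹ : ℝ) = 1 / 4 by norm_num]
      linarith
    -- the measure of the box
    have hvolE : volume E = ENNReal.ofReal d₀ * volume (ball (0 : EuclideanSpace ℝ (Fin 3)) d₀) := by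
      rw [hE, Measure.volume_eq_prod, Measure.prod_prod, Real.volume_Ioo, Measure.addHaar_ball_center]
      congr 1
      ring_nf
    -- the lower bound
    have hEm : MeasurableSet E := measurableSet_Ioo.prod measurableSet_ball
    calc m₀ = ENNReal.ofReal (4⁻¹ : ℝ) ^ (3 : ℕ) * volume E := by rw [hm₀, hvolE]
      _ = ∫⁻ _ in E, ENNReal.ofReal (4⁻¹ : ℝ) ^ (3 : ℕ) := by
          rw [lintegral_const, Measure.restrict_apply_univ]
      _ ≤ ∫⁻ q in E, ‖F j q.1 q.2‖ₑ ^ (3 : ℕ) := by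
          refine lintegral_mono_ae ?_
          have h1 : ∀ᵐ q ∂(volume.restrict E), uncurry (F j) q = uncurry V q :=
            ae_restrict_of_ae_restrict_of_subset hEQ3 hae
          filter_upwards [h1, ae_restrict_mem hEm] with q hq hqE
          have e : ‖F j q.1 q.2‖ₑ = ‖V q.1 q.2‖ₑ := by
            have : uncurry (F j) q = uncurry V q := hq
            simp only [uncurry] at this
            rw [this]
          rw [e]
          gcongr
          rw [← ofReal_norm]
          exact ENNReal.ofReal_le_ofReal (hVE q hqE)
      _ ≤ ∫⁻ q in Q3, ‖F j q.1 q.2‖ₑ ^ (3 : ℕ) := lintegral_mono_set hEQ3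
  -- ## the contradiction with `F_j → w = 0` in `L³(Q_3)`
  have hconv0 : Tendsto (fun j => eLpNorm (uncurry (F j)) 3 μ3) atTop (𝓝 0) := by
    refine (tendsto_congr fun j => ?_).1 hconv
    refine eLpNorm_congr_ae ?_
    filter_upwards [hzero] with q hq
    show uncurry (F j) q - uncurry w q = uncurry (F j) q
    have : uncurry w q = 0 := hq
    rw [this, sub_zero]
  have hlow' : ∀ j, m₀ ^ (1 / 3 : ℝ) ≤ eLpNorm (uncurry (F j)) 3 μ3 := by
    intro j
    rw [eLpNorm_eq_lintegral_rpow_enorm_toReal (by norm_num) (by norm_num), ENNReal.toReal_ofNat]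
    refine ENNReal.rpow_le_rpow ?_ (by norm_num)
    refine (hlow j).trans (le_of_eq ?_)
    refine lintegral_congr fun q => ?_
    rw [show (3 : ℝ) = ((3 : ℕ) : ℝ) by norm_num, ENNReal.rpow_natCast]
    rfl
  have hpos : (0 : ℝ≥0∞) < m₀ ^ (1 / 3 : ℝ) := ENNReal.rpow_pos hm₀pos (by
    refine ENNReal.mul_ne_top (ENNReal.pow_ne_top ENNReal.ofReal_ne_top) ?_
    exact ENNReal.mul_ne_top ENNReal.ofReal_ne_top measure_ball_lt_top.ne)
  have hev := (tendsto_order.1 hconv0).2 _ hpos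
  obtain ⟨j, hj⟩ := hev.exists
  exact absurd (hlow' j) (not_le.2 hj)

end Summit.NavierStokesRegularity.NavierStokesRegularity.Theorems.TypeITraceScarL3

end
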